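import Summits.Ventures.PercRepro.RLSRuleLinePointGeom

/-!
# PercRepro — planes with EXACTLY ONE `3`-point line: traces and shares of the witnesses (night-3, gen 3)

A plane `G` with exactly one `3`-point line `ℓ` (`OneLine`: `|ℓ| = 3`, rank `2`, every other `3`-subset of `G`
independent — on a Core matroid every plane with a single long line, since Core has no `4`-point line, mine-4 4514).
For a rank-`3` subset `B′ ⊆ G` and an independent `X` off `G`:

* `inter_eq_line_of_three_le`: a plane `G' ≠ G` meeting `G` in `≥ 3` points meets it exactly in `ℓ`;
* `not_hasLongLine_of_oneLine`: no `4`-point subset of `G` has rank `≤ 2`; `rho3_of_oneLine`: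
  `ρ₃(B′) = C(|B′|, 3) − [ℓ ⊆ B′]`;
* if `ℓ ⊄ B′` there is NO loss: every trace of `B′ ∪ X` other than `B′` has `≤ 2 + 3` points, so
  `mstar_union_eq_zero_of_oneLine_notSubset` (`|B′| ≤ 5`) / `tied_eq_singleton_of_oneLine_notSubset` (`|B′| ≥ 6`)
  and the share is at least the triple share (`wPlus_ge_of_oneLine_notSubset`);
* if `ℓ ⊆ B′`, in a GOOD witness (no coplanar triple of `K` inside `X`, `GoodWitness`) the same holds with
  `ρ₃(B′) = C(|B′|, 3) − 1` (`mstar_union_eq_zero_of_oneLine_good`, `tied_eq_singleton_of_oneLine_good`,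
  `wPlus_ge_of_oneLine_good`): share `≥ (C(b, 3) − 1) / C(b + x, 3)` for `b ≤ 5`, `1` for `b ≥ 6`.
Imports `RLSRuleLinePointGeom`.  Axioms: standard.
-/

open scoped Matroid

namespace PercRepro

namespace NightThree

open Finset ThmH PerFlat

variable {α : Type*} [DecidableEq α] {M : Matroid α} [M.Finite]

/-- `ℓ` is the unique `3`-point line of the plane `G`: `|ℓ| = 3`, rank `2`, every other `3`-subset independent. -/
def OneLine (M : Matroid α) (G ℓ : Finset α) : Prop :=
  ℓ ⊆ G ∧ ℓ.card = 3 ∧ M.eRk (ℓ : Set α) = 2 ∧ ∀ T ∈ G.powersetCard 3, T ≠ ℓ → M.Indep (T : Set α)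

omit [DecidableEq α] in
/-- A `OneLine` plane has at least `4` points. -/
theorem four_le_card_of_oneLine {G ℓ : Finset α} (hG : G ∈ flatsQ M 3) (h : OneLine M G ℓ) : 4 ≤ G.card := by
  by_contra hlt
  push Not at hlt
  have hℓc : ℓ.card = 3 := h.2.1
  have heq : G = ℓ := (Finset.eq_of_subset_of_card_le h.1 (by omega)).symm
  have := eRk_eq_three_of_mem_flatsQ' hG
  rw [heq, h.2.2.1] at this
  exact absurd this (by norm_num)

omit [M.Finite] in
/-- A `OneLine` plane is simple. -/
theorem simpleOn_of_oneLine {G ℓ : Finset α} (hG3 : 4 ≤ G.card) (h : OneLine M G ℓ) : SimpleOn M G := by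
  intro u hu v hv huv
  -- extend `{u, v}` to a `3`-subset `T`; if `T = ℓ` use another point
  obtain ⟨hℓG, hℓc, hℓr, hone⟩ := h
  have hP : ({u, v} : Finset α) ⊆ G := by
    intro x hx
    rcases Finset.mem_insert.1 hx with rfl | hx
    · exact hu
    · rw [Finset.mem_singleton] at hx; rw [hx]; exact hv
  have hPc : ({u, v} : Finset α).card = 2 := Finset.card_pair huv
  by_cases hPℓ : ({u, v} : Finset α) ⊆ ℓ
  · -- two points of the line: rank `2` from the line itself
    apply le_antisymm
    · rw [← hℓr]
      exact M.eRk_mono (by rw [← Finset.coe_pair]; exact Finset.coe_subset.2 hPℓ)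
    · -- a point of `G` off `ℓ` makes an independent triple with them
      obtain ⟨a, haG, haℓ⟩ : ∃ a ∈ G, a ∉ ℓ := by
        by_contra hcon
        push Not at hcon
        have : G ⊆ ℓ := hcon
        have := Finset.card_le_card this
        omega
      have hT : insert a ({u, v} : Finset α) ∈ G.powersetCard 3 := by
        rw [Finset.mem_powersetCard]
        refine ⟨Finset.insert_subset haG hP, ?_⟩
        rw [Finset.card_insert_of_notMem (fun h => haℓ (hPℓ h)), hPc]
      have hne : insert a ({u, v} : Finset α) ≠ ℓ := by
        intro h
        exact haℓ (h ▸ Finset.mem_insert_self a _)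
      have hind := hone _ hT hne
      have h2 : M.Indep (({u, v} : Finset α) : Set α) :=
        hind.subset (Finset.coe_subset.2 (Finset.subset_insert _ _))
      rw [← Finset.coe_pair, eRk_eq_card_of_indep h2, hPc]
      rfl
  · -- not both on the line: extend by a point of `ℓ` (the triple is not `ℓ`)
    obtain ⟨w, hwℓ, hwP⟩ : ∃ w ∈ ℓ, w ∉ ({u, v} : Finset α) := by
      by_contra hcon
      push Not at hcon
      have : ℓ ⊆ ({u, v} : Finset α) := hcon
      have := Finset.card_le_card this
      omega
    have hT : insert w ({u, v} : Finset α) ∈ G.powersetCard 3 := by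
      rw [Finset.mem_powersetCard]
      refine ⟨Finset.insert_subset (hℓG hwℓ) hP, ?_⟩
      rw [Finset.card_insert_of_notMem hwP, hPc]
    have hne : insert w ({u, v} : Finset α) ≠ ℓ := by
      intro h
      apply hPℓ
      rw [← h]
      exact Finset.subset_insert _ _
    have hind := hone _ hT hne
    have h2 : M.Indep (({u, v} : Finset α) : Set α) :=
      hind.subset (Finset.coe_subset.2 (Finset.subset_insert _ _))
    rw [← Finset.coe_pair, eRk_eq_card_of_indep h2, hPc]
    rfl

/-- A plane `G' ≠ G` meeting the `OneLine` plane `G` in at least `3` points meets it exactly in `ℓ`. -/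
theorem inter_eq_line_of_three_le {G ℓ G' : Finset α} (hG : G ∈ flatsQ M 3) (h : OneLine M G ℓ)
    (hG' : G' ∈ flatsQ M 3) (hne : G' ≠ G) (h3 : 3 ≤ (G' ∩ G).card) : G' ∩ G = ℓ := by
  obtain ⟨hℓG, hℓc, hℓr, hone⟩ := h
  -- every `3`-subset of `G' ∩ G` equals `ℓ`
  have hall : ∀ T ∈ (G' ∩ G).powersetCard 3, T = ℓ := by
    intro T hT
    rw [Finset.mem_powersetCard] at hT
    by_contra hTℓ
    have hind := hone T (Finset.mem_powersetCard.2 ⟨hT.1.trans Finset.inter_subset_right, hT.2⟩) hTℓ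
    have hT3 := eRk_eq_three_of_indep_card hind hT.2
    rw [flatsQ_three] at hG hG'
    exact hne (planes_eq_of_subset hG' hG (hT.1.trans Finset.inter_subset_left)
      (hT.1.trans Finset.inter_subset_right) hT3)
  -- so `|G' ∩ G| = 3` and the unique `3`-subset is `G' ∩ G` itself
  have hc : (G' ∩ G).card = 3 := by
    by_contra hne3
    have h4 : 4 ≤ (G' ∩ G).card := by omega
    obtain ⟨L, hL, hLc⟩ := Finset.exists_subset_card_eq h4
    -- two distinct `3`-subsets of `L`
    obtain ⟨x, hx⟩ := Finset.card_pos.1 (show 0 < L.card by omega)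
    have hLx : (L.erase x).card = 3 := by rw [Finset.card_erase_of_mem hx, hLc]
    obtain ⟨y, hy, hyx⟩ : ∃ y ∈ L, y ≠ x := by
      by_contra hcon
      push Not at hcon
      have : L ⊆ {x} := fun z hz => Finset.mem_singleton.2 (hcon z hz)
      have := Finset.card_le_card this
      rw [Finset.card_singleton] at this
      omega
    have hLy : (L.erase y).card = 3 := by rw [Finset.card_erase_of_mem hy, hLc]
    have e1 := hall (L.erase x) (Finset.mem_powersetCard.2 ⟨(Finset.erase_subset _ _).trans hL, hLx⟩)
    have e2 := hall (L.erase y) (Finset.mem_powersetCard.2 ⟨(Finset.erase_subset _ _).trans hL, hLy⟩)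
    have : y ∈ L.erase x := Finset.mem_erase.2 ⟨hyx, hy⟩
    rw [e1, ← e2] at this
    exact (Finset.mem_erase.1 this).1 rfl
  exact hall (G' ∩ G) (Finset.mem_powersetCard.2 ⟨le_rfl, hc⟩)

omit [M.Finite] in
/-- No `4`-point subset of a `OneLine` plane has rank `≤ 2`. -/
theorem not_hasLongLine_of_oneLine {G ℓ B : Finset α} (h : OneLine M G ℓ) (hB : B ⊆ G) :
    ¬ HasLongLine M B := by
  rintro ⟨L, hL, hr⟩
  rw [Finset.mem_powersetCard] at hL
  obtain ⟨hℓG, hℓc, hℓr, hone⟩ := h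
  -- `L` has a `3`-subset other than `ℓ` (it has four of them)
  obtain ⟨x, hx⟩ := Finset.card_pos.1 (show 0 < L.card by omega)
  obtain ⟨y, hy, hyx⟩ : ∃ y ∈ L, y ≠ x := by
    by_contra hcon
    push Not at hcon
    have : L ⊆ {x} := fun z hz => Finset.mem_singleton.2 (hcon z hz)
    have := Finset.card_le_card this
    rw [Finset.card_singleton] at this
    omega
  have hLx : (L.erase x).card = 3 := by rw [Finset.card_erase_of_mem hx, hL.2]
  have hLy : (L.erase y).card = 3 := by rw [Finset.card_erase_of_mem hy, hL.2]
  have hT : ∃ T ⊆ L, T.card = 3 ∧ T ≠ ℓ := by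
    by_cases h1 : L.erase x = ℓ
    · refine ⟨L.erase y, Finset.erase_subset _ _, hLy, ?_⟩
      intro h2
      have : y ∈ L.erase x := Finset.mem_erase.2 ⟨hyx, hy⟩
      rw [h1, ← h2] at this
      exact (Finset.mem_erase.1 this).1 rfl
    · exact ⟨L.erase x, Finset.erase_subset _ _, hLx, h1⟩
  obtain ⟨T, hTL, hTc, hTℓ⟩ := hT
  have hind := hone T (Finset.mem_powersetCard.2 ⟨hTL.trans (hL.1.trans hB), hTc⟩) hTℓ
  have h3 := eRk_eq_three_of_indep_card hind hTc
  have := (M.eRk_mono (Finset.coe_subset.2 hTL)).trans hr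
  rw [h3] at this
  exact absurd this (by norm_num)

omit [M.Finite] in
/-- `ρ₃(B′) = C(|B′|, 3) − [ℓ ⊆ B′]` on a `OneLine` plane. -/
theorem rho3_of_oneLine {G ℓ B : Finset α} (h : OneLine M G ℓ) (hB : B ⊆ G) :
    rho3 M B = B.card.choose 3 - (if ℓ ⊆ B then 1 else 0) := by
  classical
  obtain ⟨hℓG, hℓc, hℓr, hone⟩ := h
  unfold rho3
  have hfilter : (B.powersetCard 3).filter (fun (T : Finset α) => M.Indep (T : Set α)) =
      (B.powersetCard 3).erase ℓ := by
    ext T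
    rw [Finset.mem_filter, Finset.mem_erase, Finset.mem_powersetCard]
    constructor
    · rintro ⟨⟨hTB, hTc⟩, hTi⟩
      refine ⟨?_, hTB, hTc⟩
      rintro rfl
      have := eRk_eq_three_of_indep_card hTi hTc
      rw [hℓr] at this
      exact absurd this (by norm_num)
    · rintro ⟨hne, hTB, hTc⟩
      exact ⟨⟨hTB, hTc⟩, hone T (Finset.mem_powersetCard.2 ⟨hTB.trans hB, hTc⟩) hne⟩
  rw [hfilter]
  by_cases hℓB : ℓ ⊆ B
  · rw [if_pos hℓB, Finset.card_erase_of_mem (Finset.mem_powersetCard.2 ⟨hℓB, hℓc⟩), Finset.card_powersetCard]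
  · rw [if_neg hℓB, Finset.erase_eq_of_notMem (by
      rw [Finset.mem_powersetCard]; exact fun h => hℓB h.1), Finset.card_powersetCard]
    rfl

/-- Every trace of `B′ ∪ X` other than `B′` has at most `5` points when `ℓ ⊄ B′` (or when `X` is good). -/
theorem card_trace_le_five_of_oneLine {G ℓ K B X G' : Finset α} (hG : G ∈ flatsQ M 3) (h : OneLine M G ℓ)
    (hB : B ⊆ G) (hX : M.Indep (X : Set α)) (hXK : X ⊆ K)
    (hcase : ¬ ℓ ⊆ B ∨ GoodWitness M ℓ K X) (hG' : G' ∈ flatsQ M 3) (hne : G' ≠ G) :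
    (G' ∩ (B ∪ X)).card ≤ 5 := by
  have hle := card_inter_union_le (B := B) (X := X) hG' hX
  have hℓc : ℓ.card = 3 := h.2.1
  rcases lt_or_ge (G' ∩ G).card 3 with hlt | hge
  · have : (G' ∩ B).card ≤ (G' ∩ G).card := Finset.card_le_card (Finset.inter_subset_inter_left hB)
    omega
  · have hℓ := inter_eq_line_of_three_le hG h hG' hne hge
    rcases hcase with hnot | hgood
    · -- `G' ∩ B′ = ℓ ∩ B′` has at most `2` points
      have h2 : (G' ∩ B).card ≤ 2 := by
        have hsub : G' ∩ B ⊆ ℓ := by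
          intro x hx
          rw [Finset.mem_inter] at hx
          rw [← hℓ, Finset.mem_inter]
          exact ⟨hx.1, hB hx.2⟩
        by_contra hc
        push Not at hc
        have : G' ∩ B = ℓ := Finset.eq_of_subset_of_card_le hsub (by omega)
        apply hnot
        rw [← this]
        exact Finset.inter_subset_right
      omega
    · -- `G' ∩ B′ ⊆ ℓ` (3 points) and `|G' ∩ X| ≤ 2` on a good witness
      have h3 : (G' ∩ B).card ≤ 3 := by
        have hsub : G' ∩ B ⊆ ℓ := by
          intro x hx
          rw [Finset.mem_inter] at hx
          rw [← hℓ, Finset.mem_inter]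
          exact ⟨hx.1, hB hx.2⟩
        exact (Finset.card_le_card hsub).trans (by rw [h.2.1])
      have hGX : (G' ∩ X).card ≤ 2 := by
        by_contra hc
        push Not at hc
        have hind : M.Indep ((G' ∩ X : Finset α) : Set α) :=
          hX.subset (Finset.coe_subset.2 Finset.inter_subset_right)
        have hle3 : M.eRk ((G' ∩ X : Finset α) : Set α) ≤ 3 := by
          rw [← eRk_eq_three_of_mem_flatsQ' hG']
          exact M.eRk_mono (Finset.coe_subset.2 Finset.inter_subset_left)
        rw [eRk_eq_card_of_indep hind] at hle3
        have hc3 : (G' ∩ X).card = 3 := le_antisymm (by exact_mod_cast hle3) hc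
        apply hgood (G' ∩ X)
        · unfold coplanarTriples
          rw [Finset.mem_filter, Finset.mem_powersetCard]
          refine ⟨⟨Finset.inter_subset_right.trans hXK, hc3⟩, ?_⟩
          rw [← eRk_eq_three_of_mem_flatsQ' hG']
          apply M.eRk_mono
          rw [Finset.coe_union]
          apply Set.union_subset
          · rw [← hℓ, Finset.coe_inter]; exact Set.inter_subset_left
          · rw [Finset.coe_inter]; exact Set.inter_subset_left
        · exact Finset.inter_subset_right
      have : (G' ∩ (B ∪ X)).card ≤ (G' ∩ B).card + (G' ∩ X).card := by
        rw [Finset.inter_union_distrib_left]; exact Finset.card_union_le _ _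
      omega

/-- With `|B′| ≤ 5` (and no loss: `ℓ ⊄ B′` or a good witness) every trace is in `𝒯₀`. -/
theorem mstar_union_eq_zero_of_oneLine {G ℓ K B X : Finset α} (hG : G ∈ flatsQ M 3) (h : OneLine M G ℓ)
    (hB : B ⊆ G) (hBc : B.card ≤ 5) (hX : M.Indep (X : Set α)) (hXG : Disjoint X G) (hXK : X ⊆ K)
    (hcase : ¬ ℓ ⊆ B ∨ GoodWitness M ℓ K X) : mstar M (B ∪ X) = 0 := by
  have hsimple : SimpleOn M G := simpleOn_of_oneLine (four_le_card_of_oneLine hG h) h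
  rw [mstar_eq_zero_iff]
  intro G' hG' hn
  obtain ⟨_, hbig⟩ := hn
  rcases hbig with h6 | hline
  · by_cases hGG : G' = G
    · rw [hGG, inter_union_eq_of_disjoint hB hXG] at h6
      exact absurd (h6.trans hBc) (by norm_num)
    · have := card_trace_le_five_of_oneLine hG h hB hX hXK hcase hG' hGG
      omega
  · exact not_hasLongLine_of_oneLine h hB
      (hasLongLine_of_union hG hsimple hB hX hXG Finset.inter_subset_right hline)

/-- With `|B′| ≥ 6` (and no loss) the plane `G` is the unique tied plane of `B′ ∪ X`. -/
theorem tied_eq_singleton_of_oneLine {G ℓ K B X : Finset α} (hG : G ∈ flatsQ M 3) (h : OneLine M G ℓ)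
    (hB : B ⊆ G) (hBc : 6 ≤ B.card) (hX : M.Indep (X : Set α)) (hXG : Disjoint X G) (hXK : X ⊆ K)
    (hcase : ¬ ℓ ⊆ B ∨ GoodWitness M ℓ K X) : tied M (B ∪ X) = {G} := by
  have hsimple : SimpleOn M G := simpleOn_of_oneLine (four_le_card_of_oneLine hG h) h
  have hBtrace : G ∩ (B ∪ X) = B := inter_union_eq_of_disjoint hB hXG
  have hB3 : M.eRk (B : Set α) = 3 := by
    -- `B′` contains a `3`-subset other than `ℓ`
    apply le_antisymm
    · rw [← eRk_eq_three_of_mem_flatsQ' hG]; exact M.eRk_mono (Finset.coe_subset.2 hB)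
    · obtain ⟨hℓG, hℓc, hℓr, hone⟩ := h
      obtain ⟨x, hx⟩ := Finset.card_pos.1 (show 0 < B.card by omega)
      obtain ⟨T, hTB, hTc, hTℓ⟩ : ∃ T ⊆ B, T.card = 3 ∧ T ≠ ℓ := by
        by_cases hℓB : ℓ ⊆ B
        · obtain ⟨a, haB, haℓ⟩ : ∃ a ∈ B, a ∉ ℓ := by
            by_contra hcon
            push Not at hcon
            have := Finset.card_le_card (show B ⊆ ℓ from hcon)
            omega
          obtain ⟨P, hPℓ, hPc⟩ := Finset.exists_subset_card_eq (show 2 ≤ ℓ.card by omega)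
          refine ⟨insert a P, Finset.insert_subset haB (hPℓ.trans hℓB), ?_, ?_⟩
          · rw [Finset.card_insert_of_notMem (fun h => haℓ (hPℓ h)), hPc]
          · intro h
            exact haℓ (h ▸ Finset.mem_insert_self a P)
        · obtain ⟨T, hTB, hTc⟩ := Finset.exists_subset_card_eq (show 3 ≤ B.card by omega)
          by_cases hTℓ : T = ℓ
          · exact absurd (hTℓ ▸ hTB) hℓB
          · exact ⟨T, hTB, hTc, hTℓ⟩
      have hind := hone T (Finset.mem_powersetCard.2 ⟨hTB.trans hB, hTc⟩) hTℓ
      rw [← eRk_eq_three_of_indep_card hind hTc]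
      exact M.eRk_mono (Finset.coe_subset.2 hTB)
  have hnon : NonT0 M (G ∩ (B ∪ X)) := by
    rw [hBtrace]
    exact ⟨hB3, Or.inl hBc⟩
  have hother : ∀ G' ∈ flatsQ M 3, G' ≠ G → ¬ NonT0 M (G' ∩ (B ∪ X)) := by
    intro G' hG' hne hn
    obtain ⟨_, hbig⟩ := hn
    rcases hbig with h6 | hline
    · have := card_trace_le_five_of_oneLine hG h hB hX hXK hcase hG' hne
      omega
    · exact not_hasLongLine_of_oneLine h hB
        (hasLongLine_of_union hG hsimple hB hX hXG Finset.inter_subset_right hline)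
  have hm : mstar M (B ∪ X) = (G ∩ (B ∪ X)).card := by
    classical
    unfold mstar
    apply le_antisymm
    · apply Finset.sup_le
      intro G' hG'
      rw [Finset.mem_filter] at hG'
      by_cases hne : G' = G
      · rw [hne]
      · exact absurd hG'.2 (hother G' hG'.1 hne)
    · exact Finset.le_sup (f := fun G' => (G' ∩ (B ∪ X)).card) (Finset.mem_filter.2 ⟨hG, hnon⟩)
  ext G'
  rw [mem_tied, Finset.mem_singleton]
  constructor
  · rintro ⟨hG', hn, _⟩
    by_contra hne
    exact hother G' hG' hne hn
  · rintro rfl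
    exact ⟨hG, hnon, hm.symm⟩

/-- **The share on a `OneLine` plane without loss.**  For `B′ ⊆ G`, `ℓ ⊄ B′` or a good witness:
`w⁺(G, B′ ∪ X) ≥ (C(b, 3) − [ℓ ⊆ B′]) / C(b + x, 3)` for `b ≤ 5`, and `= 1` for `b ≥ 6`. -/
theorem wPlus_ge_of_oneLine {G ℓ K B X : Finset α} (hG : G ∈ flatsQ M 3) (h : OneLine M G ℓ)
    (hB : B ⊆ G) (hX : M.Indep (X : Set α)) (hXG : Disjoint X G) (hXK : X ⊆ K)
    (hcase : ¬ ℓ ⊆ B ∨ GoodWitness M ℓ K X) :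
    (if B.card ≤ 5 then ((B.card.choose 3 - (if ℓ ⊆ B then 1 else 0) : ℕ) : ℚ) /
        (((B.card + X.card).choose 3 : ℕ) : ℚ) else 1) ≤ wPlus M G (B ∪ X) := by
  have hS : B ∪ X ⊆ gr M := by
    apply Finset.union_subset (hB.trans (mem_flatsQ.1 hG).1)
    rw [← Finset.coe_subset, coe_gr]
    exact hX.subset_ground
  have hBtrace : G ∩ (B ∪ X) = B := inter_union_eq_of_disjoint hB hXG
  have hXB : Disjoint X B := Finset.disjoint_of_subset_right hB hXG
  rcases le_or_gt B.card 5 with h5 | h6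
  · rw [if_pos h5]
    have hw := wPlus_ge_of_mstar_zero hS (mstar_union_eq_zero_of_oneLine hG h hB h5 hX hXG hXK hcase) G
    rw [hBtrace, rho3_of_oneLine h hB, Finset.card_union_of_disjoint hXB.symm] at hw
    exact hw
  · rw [if_neg (by omega)]
    apply le_of_eq
    symm
    apply wPlus_eq_one_of_unique hS
    · rw [tied_eq_singleton_of_oneLine hG h hB (by omega) hX hXG hXK hcase]
      exact Finset.mem_singleton_self G
    · intro G' hG'
      rw [tied_eq_singleton_of_oneLine hG h hB (by omega) hX hXG hXK hcase] at hG'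
      exact Finset.mem_singleton.1 hG'

end NightThree

end PercRepro
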